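import Mathlib.Algebra.Order.Ring.Int
import Summits.MatrixMultiplication.MatrixMultiplication.Theorems.ObstructionDescentWitnessPoints
import Summits.MatrixMultiplication.MatrixMultiplication.Theorems.ObstructionDescentCornerEquations

set_option linter.dupNamespace false

/-!
# Format monotonicity, the conductor law, and the window theorem for passing levels (decomp-mm · lens 3 · gen 12; H11a–d made kernel)

Route `route-MatrixMultiplication-ObstructionDescent` (sub-problem `MatrixMultiplication`, `ω(ℂ) = 2`), rev 7 `3f9f51b758cc`; support for
the aside **`InvariantSaturation`** (item `stmt-MatrixMultiplication-32282`, the invariant tower) and, through the landed block reduction,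
for `BlockLinearSaturation` (item `stmt-MatrixMultiplication-33327`).  Continues the LANDED level calculus (`ObstructionDescentInvariantTower`:
`passLevels` / `pointLevels` / `emptyLevels`, `add_mem_passLevels`, R1 `mem_passLevels_of_degree_le`; `ObstructionDescentWitnessPoints`:
`not_mem_orbitVanishing_of_witness`; `ObstructionDescentCornerEquations`: `tensorRank_fromCols_le`).  Restates nothing; defines no proposition.
* **§1 Format monotonicity (H11a).** `passLevels m N ⊆ passLevels m' N` for `N ≤ m ≤ m'` (`passLevels_mono`; level form of
  `σ_m ⊆ σ_{m'}`).  The TOP-ALIGNED enlargement `Fin m ↪ Fin (d+m)` transports weight vectors: renamed along it, a weight vector of type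
  `Λ` is a weight vector of `Λ` EXTENDED BY ZERO on the new low coordinates (`liftPoly_mem_hwvSpace`: an upper-triangular matrix acts on
  the top corner through its lower-right block, `cornerOf_actTensor`), right-aligned rectangular types go to right-aligned rectangular
  types (`liftType_rectType`), the renamed vector takes the old value at the zero-padded point (`cornerOf_padTensor`), and a format-`m`
  witness `[A|B|C]` has rank `≤ m ≤ d+m`, so the witness principle applies.  Also `pointLevels_subset_pointLevels_pad`.
* **§2 Conductor law (H11b).** `passLevels m N` and `pointLevels N t` are numerical semigroups (landed), so by Sylvester–Frobenius
  (Mathlib `Nat.exists_add_mul_eq_of_gcd_dvd_of_mul_pred_le`) two levels `a, b` force every level `k ≥ (a−1)(b−1)` divisible by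
  `gcd(a,b)` (`mem_passLevels_of_gcd_dvd`, `mem_pointLevels_of_gcd_dvd`) and a RUN `a, …, 2a−1` forces every level `≥ a`
  (`mem_passLevels_of_run`) — the level form, with explicit conductor, of BI17 Thm 5.3 (`E(w)` generates `m·a(w)·ℤ`) and Problem 5.19.
* **§3 One cell decides a column (H11c).** A passing run at ONE cell `m₀` gives every level `≥ a` at EVERY cell `m ≥ m₀`
  (`column_of_run`); at tree level `invariantSaturation_of_firstCellRuns`.  Column `n = 3` (`N = 9`, `E'(9) = ⟨3,4,5⟩`, BI17 Ex. 5.6):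
  certificates for the levels `3, 4, 5` at one cell `m₀ ≥ 18` give the tower at every cell `m ≥ m₀` (`tower_column_three`); the levels
  `3, 4` alone give it at every cell `m ≥ max m₀ 45` (`tower_column_three_of_two`) and leave exactly level `5` open below
  (`column_three_of_two`).  (Census T15, `F_3(⟨9⟩ + t·P) = −41150592000 (t⁹ + t¹⁸)` at a rank-`≤ 18` point, is the intended discharge of
  the level-`3` certificate; nothing here depends on it.)
* **§4 Window theorem (H11d).** At a cell with `2n·n² ≤ m` the window levels `n ≤ k < 2n` have degree `≤ m`, so they pass as soon as
  they are NON-EMPTY (R1), and the conductor law then gives every level `≥ n`: the tower at such cells — hence its level reading at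
  every scale `3 < τ < 4` — follows from (K0) and the Kronecker positivity `k_{n²}(k) > 0`, `n ≤ k < 2n` (BI17 Problem 5.19) ALONE
  (`tower_of_nonemptyWindow`, `invariantSaturation_three_of_nonemptyWindows`); the landed H6a/H6b needed in addition the unit-tensor
  hypotheses (U) (BI17 Problem 5.23, Latin cubes — open) and (Ko).
All statements over `ℂ`; hypotheses inline; no `sorry`; standard axioms.
[cite: BurgisserIkenmeyer2017, §5 Def 5.2, Thm 5.3, Thm 5.9, Ex. 5.6, Problems 5.19 and 5.23; BurgisserIkenmeyer2011, §2 (2.2), Lemma 3.2;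
LandsbergGCT2017, §8.3.3]
-/

noncomputable section

open scoped BigOperators
open Finset

namespace Summit.MatrixMultiplication.MatrixMultiplication.Theorems.ObstructionCalculus

open Literature.Computability.AlgebraicComplexity (tensorRank unitTensor actTensor actTensor_apply)
open Summit.MatrixMultiplication.MatrixMultiplication.Theorems.ObstructionDescentCornerEquations (tensorRank_fromCols_le)

/-! ### §1 · Format monotonicity: the top-aligned enlargement `m ↦ d + m` transports weight vectors -/

section FormatLift

variable {m d : ℕ}

variable (d) in
/-- The top-aligned enlargement on tensor coordinates: `(a,b,c) ↦ (d+a, d+b, d+c)`. [bookkeeping] -/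
def liftI (p : Idx m) : Idx (d + m) := (Fin.natAdd d p.1, Fin.natAdd d p.2.1, Fin.natAdd d p.2.2)

variable (d) in
/-- A polynomial on the format `m` read on the TOP CORNER of the format `d + m`. [bookkeeping] -/
def liftPoly (f : MvPolynomial (Idx m) ℂ) : MvPolynomial (Idx (d + m)) ℂ := MvPolynomial.rename (liftI d) f

variable (d) in
/-- The top `m × m × m` corner of a tensor of format `d + m`. [bookkeeping] -/
def cornerOf (t : Tensor ℂ (d + m)) : Tensor ℂ m := fun a b c => t (Fin.natAdd d a) (Fin.natAdd d b) (Fin.natAdd d c)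

variable (d) in
/-- The lower-right `m × m` block of a square matrix of size `d + m`. [bookkeeping] -/
def blk (A : Matrix (Fin (d + m)) (Fin (d + m)) ℂ) : Matrix (Fin m) (Fin m) ℂ :=
  fun a b => A (Fin.natAdd d a) (Fin.natAdd d b)

variable (d) in
/-- A type `Λ` on the format `m` EXTENDED BY ZERO on the `d` new low coordinates. [bookkeeping] -/
def liftType (Λ : Fin 3 → Fin m → ℕ) : Fin 3 → Fin (d + m) → ℕ := fun s => Fin.append (fun _ : Fin d => 0) (Λ s)

/-- The renamed polynomial evaluates at `t` as the original at the corner of `t`. [bookkeeping] -/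
theorem evalT_liftPoly (t : Tensor ℂ (d + m)) (f : MvPolynomial (Idx m) ℂ) :
    evalT t (liftPoly d f) = evalT (cornerOf d t) f := by
  unfold evalT liftPoly; rw [MvPolynomial.aeval_rename]; rfl

/-- A sum over `Fin (d + m)` whose low part vanishes is the sum over the top corner. [bookkeeping] -/
theorem sum_univ_add_eq_right {M : Type*} [AddCommMonoid M] (F : Fin (d + m) → M)
    (hF : ∀ i : Fin d, F (Fin.castAdd m i) = 0) : ∑ l, F l = ∑ j : Fin m, F (Fin.natAdd d j) := by
  rw [Fin.sum_univ_add, Finset.sum_eq_zero (fun i _ => hF i), zero_add]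

/-- An upper-triangular matrix has no entry from a corner row into a low column. [bookkeeping] -/
theorem borel_apply_natAdd_castAdd {A : Matrix (Fin (d + m)) (Fin (d + m)) ℂ} (hA : A ∈ borel (d + m)) (a : Fin m)
    (i : Fin d) : A (Fin.natAdd d a) (Fin.castAdd m i) = 0 :=
  hA.1 _ _ (by rw [Fin.lt_def, Fin.val_castAdd, Fin.val_natAdd]; omega)

/-- **Upper-triangular matrices act on the top corner through their lower-right blocks.** [this node] -/
theorem cornerOf_actTensor {A B C : Matrix (Fin (d + m)) (Fin (d + m)) ℂ} (hA : A ∈ borel (d + m)) (hB : B ∈ borel (d + m))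
    (hC : C ∈ borel (d + m)) (t : Tensor ℂ (d + m)) :
    cornerOf d (actTensor A B C t) = actTensor (blk d A) (blk d B) (blk d C) (cornerOf d t) := by
  funext a b c
  show actTensor A B C t (Fin.natAdd d a) (Fin.natAdd d b) (Fin.natAdd d c) = _
  rw [actTensor_apply, actTensor_apply]
  rw [sum_univ_add_eq_right _ (fun i => by simp [borel_apply_natAdd_castAdd hA a i])]
  refine Finset.sum_congr rfl fun a' _ => ?_
  rw [sum_univ_add_eq_right _ (fun i => by simp [borel_apply_natAdd_castAdd hB b i])]
  refine Finset.sum_congr rfl fun b' _ => ?_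
  rw [sum_univ_add_eq_right _ (fun i => by simp [borel_apply_natAdd_castAdd hC c i])]
  rfl

/-- The lower-right block of an upper-triangular invertible matrix is upper-triangular invertible. [bookkeeping] -/
theorem blk_mem_borel {A : Matrix (Fin (d + m)) (Fin (d + m)) ℂ} (hA : A ∈ borel (d + m)) : blk d A ∈ borel m := by
  refine ⟨fun i j hij => hA.1 _ _ ?_, fun i => hA.2 _⟩
  rw [Fin.lt_def, Fin.val_natAdd, Fin.val_natAdd]
  exact Nat.add_lt_add_left (Fin.lt_def.1 hij) d

/-- The character of the extended type is the character of the type on the lower-right block. [bookkeeping] -/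
theorem weightChar_liftType (Λ : Fin 3 → Fin m → ℕ) (s : Fin 3) (A : Matrix (Fin (d + m)) (Fin (d + m)) ℂ) :
    weightChar (liftType d Λ s) A = weightChar (Λ s) (blk d A) := by
  simp only [weightChar, liftType, Fin.prod_univ_add, Fin.append_left, pow_zero, Finset.prod_const_one, one_mul,
    Fin.append_right]
  rfl

/-- **Format enlargement transports weight vectors (H11a, engine).**  A weight vector of type `Λ` and degree `e` on the format `m`,
read on the top corner of the format `d + m`, is a weight vector of the type `Λ` extended by zero, same degree. [this node] -/
theorem liftPoly_mem_hwvSpace {Λ : Fin 3 → Fin m → ℕ} {e : ℕ} {f : MvPolynomial (Idx m) ℂ} (hf : f ∈ hwvSpace Λ e) :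
    liftPoly d f ∈ hwvSpace (liftType d Λ) e := by
  refine ⟨hf.1.rename_isHomogeneous, fun A B C hA hB hC t => ?_⟩
  rw [evalT_liftPoly, evalT_liftPoly, cornerOf_actTensor hA hB hC,
    hf.2 _ _ _ (blk_mem_borel hA) (blk_mem_borel hB) (blk_mem_borel hC), weightChar_liftType, weightChar_liftType,
    weightChar_liftType]

/-- Right-aligned rectangular types extend to right-aligned rectangular types (`N ≤ m`). [bookkeeping] -/
theorem liftType_rectType {N : ℕ} (hN : N ≤ m) (k : ℕ) : liftType d (rectType m N k) = rectType (d + m) N k := by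
  funext s l
  induction l using Fin.addCases with
  | left i =>
    simp only [liftType, Fin.append_left, rectType, Fin.val_castAdd]
    have hi := i.2
    rw [if_neg (by omega)]
  | right j =>
    simp only [liftType, Fin.append_right, rectType, Fin.val_natAdd]
    by_cases h : m ≤ (j : ℕ) + N
    · rw [if_pos h, if_pos (by omega)]
    · rw [if_neg h, if_neg (by omega)]

/-- The top corner of the zero-padded tensor is the tensor. [bookkeeping] -/
theorem cornerOf_padTensor (p : Tensor ℂ m) : cornerOf d (padTensor (Fin.natAdd d) p) = p := by
  funext a b c
  show (∑ q : Idx m, (if Fin.natAdd d q.1 = Fin.natAdd d a ∧ Fin.natAdd d q.2.1 = Fin.natAdd d b ∧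
      Fin.natAdd d q.2.2 = Fin.natAdd d c then (1 : ℂ) else 0) * p q.1 q.2.1 q.2.2) = p a b c
  simp only [Fin.natAdd_inj]
  rw [Finset.sum_eq_single (a, b, c)]
  · simp
  · rintro ⟨a', b', c'⟩ _ hne
    have : ¬ (a' = a ∧ b' = b ∧ c' = c) := fun h => hne (by obtain ⟨rfl, rfl, rfl⟩ := h; rfl)
    simp [this]
  · intro h
    exact absurd (Finset.mem_univ _) h

/-- **H11a · format monotonicity of passing levels (additive form).**  A level passing at the secant order `m` passes at every
larger order `d + m` (`N ≤ m`): the format-`m` witness `[A|B|C]` has rank `≤ m ≤ d + m`, its zero-padding is a point of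
`Mat³·⟨d+m⟩`, and the transported weight vector takes the old non-zero value there. [this node] -/
theorem passLevels_subset_passLevels_add {N : ℕ} (hN : N ≤ m) (d : ℕ) : passLevels m N ⊆ passLevels (d + m) N := by
  intro k hk
  obtain ⟨f, hfW, hfOV⟩ := SetLike.not_le_iff_exists.1 hk
  simp only [mem_orbitVanishing, not_forall] at hfOV
  obtain ⟨A, B, C, _, _, _, hne⟩ := hfOV
  rw [actTensor_unitTensor] at hne
  have hr : tensorRank (fromCols A B C) ≤ d + m := (tensorRank_fromCols_le A B C).trans (Nat.le_add_left m d)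
  have hW' : liftPoly d f ∈ hwvSpace (rectType (d + m) N k) (k * N) := by
    rw [← liftType_rectType hN]
    exact liftPoly_mem_hwvSpace hfW
  have hval : evalT (padTensor (Fin.natAdd d) (fromCols A B C)) (liftPoly d f) ≠ 0 := by
    rwa [evalT_liftPoly, cornerOf_padTensor]
  intro hle
  exact not_mem_orbitVanishing_of_witness (Fin.natAdd d) hr hval (hle hW')

/-- **H11a · format monotonicity of passing levels: `passLevels m N ⊆ passLevels m' N` for `N ≤ m ≤ m'`** (the secant order only
helps; level form of `σ_m ⊆ σ_{m'}`). [this node] -/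
theorem passLevels_mono {N m' : ℕ} (hN : N ≤ m) (h : m ≤ m') : passLevels m N ⊆ passLevels m' N := by
  obtain ⟨d, rfl⟩ := Nat.exists_eq_add_of_le' h
  exact passLevels_subset_passLevels_add hN d

/-- The levels of a point survive zero-padding into a larger format (`N ≤ m`). [this node] -/
theorem pointLevels_subset_pointLevels_pad {N : ℕ} (hN : N ≤ m) (d : ℕ) (p : Tensor ℂ m) :
    pointLevels N p ⊆ pointLevels N (padTensor (Fin.natAdd d) p) := by
  rintro k ⟨f, hfW, hval⟩
  refine ⟨liftPoly d f, ?_, ?_⟩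
  · rw [← liftType_rectType hN]
    exact liftPoly_mem_hwvSpace hfW
  · rwa [evalT_liftPoly, cornerOf_padTensor]

end FormatLift

/-! ### §2 · The conductor law: passing levels and point levels are numerical semigroups -/

section Conductor

variable {m N : ℕ}

/-- Multiples of a passing level pass. [bookkeeping] -/
theorem mul_mem_passLevels {a : ℕ} (ha : a ∈ passLevels m N) : ∀ j : ℕ, j * a ∈ passLevels m N
  | 0 => by simpa using zero_mem_passLevels (m := m) N
  | j + 1 => by
    rw [Nat.succ_mul]
    exact add_mem_passLevels (mul_mem_passLevels ha j) ha

/-- `ℕ`-combinations of passing levels pass. [bookkeeping] -/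
theorem mul_add_mul_mem_passLevels {a b : ℕ} (ha : a ∈ passLevels m N) (hb : b ∈ passLevels m N) (i j : ℕ) :
    i * a + j * b ∈ passLevels m N :=
  add_mem_passLevels (mul_mem_passLevels ha i) (mul_mem_passLevels hb j)

/-- **H11b · conductor law for passing levels (Sylvester–Frobenius).**  Two passing levels `a, b` force every level
`k ≥ (a−1)(b−1)` divisible by `gcd(a,b)`; for coprime `a, b` the passing levels are cofinite with conductor `≤ (a−1)(b−1)`.
[cite: BurgisserIkenmeyer2017, Thm 5.3, Problem 5.19] -/
theorem mem_passLevels_of_gcd_dvd {a b k : ℕ} (ha : a ∈ passLevels m N) (hb : b ∈ passLevels m N) (hdvd : a.gcd b ∣ k)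
    (hk : (a - 1) * (b - 1) ≤ k) : k ∈ passLevels m N := by
  obtain ⟨i, j, rfl⟩ := Nat.exists_add_mul_eq_of_gcd_dvd_of_mul_pred_le a b k hdvd
    (by simpa only [Nat.pred_eq_sub_one] using hk)
  exact mul_add_mul_mem_passLevels ha hb i j

/-- **H11b · a passing run `a, a+1, …, 2a−1` forces every level `≥ a`.** [this node] -/
theorem mem_passLevels_of_run {a : ℕ} (ha : 0 < a) (h : ∀ j : ℕ, j < a → a + j ∈ passLevels m N) :
    ∀ k : ℕ, a ≤ k → k ∈ passLevels m N := by
  intro k hk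
  obtain ⟨q, r, hr, rfl⟩ : ∃ q r : ℕ, r < a ∧ k = a * q + r := ⟨k / a, k % a, Nat.mod_lt _ ha, (Nat.div_add_mod k a).symm⟩
  obtain ⟨q', rfl⟩ : ∃ q' : ℕ, q = q' + 1 := by
    rcases q with _ | q
    · simp only [mul_zero, zero_add] at hk; omega
    · exact ⟨q, rfl⟩
  rw [show a * (q' + 1) + r = q' * a + (a + r) by ring]
  exact add_mem_passLevels (mul_mem_passLevels (by simpa using h 0 ha) q') (h r hr)

/-- Multiples of a level of a point are levels of the point. [bookkeeping] -/
theorem mul_mem_pointLevels {a : ℕ} {t : Tensor ℂ m} (ha : a ∈ pointLevels N t) : ∀ j : ℕ, j * a ∈ pointLevels N t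
  | 0 => by simpa using zero_mem_pointLevels (m := m) N t
  | j + 1 => by
    rw [Nat.succ_mul]
    exact add_mem_pointLevels (mul_mem_pointLevels ha j) ha

/-- **H11b · conductor law for the levels of a point** (the exponent monoid `E'(w)` of a polystable point generates a group,
BI17 Thm 5.3; here with the explicit conductor): two levels `a, b` of `t` force every level `k ≥ (a−1)(b−1)` divisible by
`gcd(a,b)`. [cite: BurgisserIkenmeyer2017, Thm 5.3] -/
theorem mem_pointLevels_of_gcd_dvd {a b k : ℕ} {t : Tensor ℂ m} (ha : a ∈ pointLevels N t) (hb : b ∈ pointLevels N t)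
    (hdvd : a.gcd b ∣ k) (hk : (a - 1) * (b - 1) ≤ k) : k ∈ pointLevels N t := by
  obtain ⟨i, j, rfl⟩ := Nat.exists_add_mul_eq_of_gcd_dvd_of_mul_pred_le a b k hdvd
    (by simpa only [Nat.pred_eq_sub_one] using hk)
  exact add_mem_pointLevels (mul_mem_pointLevels ha i) (mul_mem_pointLevels hb j)

end Conductor

/-! ### §3 · One cell decides a column -/

section Column

variable {N : ℕ}

/-- **H11c · one cell decides a column.**  A passing run `a, …, 2a−1` at a cell `m₀ ≥ N` gives every level `≥ a` at every cell
`m ≥ m₀`. [this node] -/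
theorem column_of_run {m₀ a : ℕ} (hN : N ≤ m₀) (ha : 0 < a) (h : ∀ j : ℕ, j < a → a + j ∈ passLevels m₀ N) :
    ∀ m : ℕ, m₀ ≤ m → ∀ k : ℕ, a ≤ k → k ∈ passLevels m N :=
  fun _ hm k hk => passLevels_mono hN hm (mem_passLevels_of_run ha h k hk)

/-- **The column `n = 3` from three certificates.**  If the levels `3, 4, 5` of the corner format `9 = 3²` pass at ONE cell
`m₀ ≥ 18`, then at every cell `m ≥ m₀` every level of degree `9k > m` passes (levels `1, 2` have degree `≤ 18 ≤ m`).
[this node] -/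
theorem tower_column_three {m₀ : ℕ} (h18 : 18 ≤ m₀) (h3 : 3 ∈ passLevels m₀ 9) (h4 : 4 ∈ passLevels m₀ 9)
    (h5 : 5 ∈ passLevels m₀ 9) : ∀ m : ℕ, m₀ ≤ m → ∀ k : ℕ, m < k * 9 → k ∈ passLevels m 9 := by
  intro m hm k hk
  refine column_of_run (a := 3) (by omega) (by norm_num) (fun j hj => ?_) m hm k (by omega)
  interval_cases j
  · exact h3
  · exact h4
  · exact h5

/-- **The column `n = 3` above degree `45` from two certificates.**  If the levels `3, 4` pass at one cell `m₀ ≥ 9` then at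
every cell `m ≥ max m₀ 45` every level of degree `9k > m` passes: such `k` are `≥ 6 = (3−1)(4−1)`, the conductor of `⟨3,4⟩`.
[this node] -/
theorem tower_column_three_of_two {m₀ : ℕ} (h9 : 9 ≤ m₀) (h3 : 3 ∈ passLevels m₀ 9) (h4 : 4 ∈ passLevels m₀ 9) :
    ∀ m : ℕ, max m₀ 45 ≤ m → ∀ k : ℕ, m < k * 9 → k ∈ passLevels m 9 := by
  intro m hm k hk
  have hm₀ : m₀ ≤ m := le_trans (le_max_left _ _) hm
  have h45 : 45 ≤ m := le_trans (le_max_right _ _) hm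
  refine passLevels_mono h9 hm₀ (mem_passLevels_of_gcd_dvd h3 h4 ?_ (by omega))
  exact (show Nat.gcd 3 4 = 1 by decide) ▸ one_dvd k

/-- **The column `n = 3`, all levels but `5`, from two certificates.**  Levels `3, 4` passing at one cell `m₀ ≥ 9` give the
levels `3, 4` and every level `≥ 6` at every cell `m ≥ m₀`; level `5` (degree `45`: `k_9(5) > 0`, BI17 Ex. 5.6) is the one
level the pair does not decide below degree `45`. [this node] -/
theorem column_three_of_two {m₀ : ℕ} (h9 : 9 ≤ m₀) (h3 : 3 ∈ passLevels m₀ 9) (h4 : 4 ∈ passLevels m₀ 9) :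
    ∀ m : ℕ, m₀ ≤ m → ∀ k : ℕ, 3 ≤ k → k ≠ 5 → k ∈ passLevels m 9 := by
  intro m hm k hk hk5
  refine passLevels_mono h9 hm ?_
  by_cases hk6 : 6 ≤ k
  · refine mem_passLevels_of_gcd_dvd h3 h4 ?_ (by omega)
    exact (show Nat.gcd 3 4 = 1 by decide) ▸ one_dvd k
  · interval_cases k
    · exact h3
    · exact h4
    · exact absurd rfl hk5

end Column

/-! ### §4 · Above the cubic wall the tower is Kronecker positivity alone -/

section Window

variable {m : ℕ}

/-- **H11d (cell theorem): above the wall `2n·n² ≤ m` the tower at `(n, m)` follows from (K0) and (NE) alone.**  (K0) the levels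
`0 < k < n` are empty (BI17 Thm 5.9(1)); (NE) the levels `n ≤ k < 2n` are NON-EMPTY at the cell (Kronecker positivity
`k_{n²}(k) > 0` on the window `[n, 2n)` — BI17 Thm 5.9(3) for `k = n`, Problem 5.19 in general).  Then every level of degree
`> m` passes or is empty: the window levels have degree `≤ (2n−1)·n² ≤ m`, so they pass by R1, and the run `n, …, 2n−1` forces
every level `≥ n` by the conductor law.  Compared with the landed H6a (`tower_of_unitLevels`) the unit-tensor hypotheses (U)
(BI17 Problem 5.23, Latin cubes) and (Ko) are GONE. [this node] -/
theorem tower_of_nonemptyWindow (n : ℕ) (hn : 0 < n) (hm : 2 * n * (n * n) ≤ m)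
    (hK0 : ∀ k : ℕ, 0 < k → k < n → k ∈ emptyLevels m (n * n))
    (hNE : ∀ k : ℕ, n ≤ k → k < 2 * n → k ∉ emptyLevels m (n * n)) :
    ∀ k : ℕ, m < k * (n * n) → k ∈ passLevels m (n * n) ∪ emptyLevels m (n * n) := by
  intro k hk
  rw [Set.mem_union, or_iff_not_imp_right]
  intro hne
  have hk0 : 0 < k := by
    rcases Nat.eq_zero_or_pos k with h0 | h0
    · subst h0; simp at hk
    · exact h0
  have hkn : n ≤ k := by
    by_contra hlt
    exact hne (hK0 k hk0 (lt_of_not_ge hlt))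
  refine mem_passLevels_of_run hn (fun j hj => mem_passLevels_of_degree_le ?_ (hNE (n + j) (by omega) (by omega))) k hkn
  exact le_trans (Nat.mul_le_mul_right _ (by omega : n + j ≤ 2 * n)) hm

end Window

end Summit.MatrixMultiplication.MatrixMultiplication.Theorems.ObstructionCalculus

/-! ### §3 at tree level: the invariant tower from first-cell runs -/

namespace Summit.MatrixMultiplication.MatrixMultiplication.Theses.ObstructionDescent

open Summit.MatrixMultiplication.MatrixMultiplication.Theorems.ObstructionCalculus

/-- **H11c at tree level (CONDITIONAL reduction; credits nothing by itself).**  `InvariantSaturation` follows if, for every scale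
`2 < τ < 4`, eventually in `n`: (K0) the levels `0 < k < n` are empty at every cell `m ≥ n²` (BI17 Thm 5.9(1)), and (RUN) at SOME
cell `m₀` with `n² ≤ m₀ ≤ n^τ` the run of levels `n, n+1, …, 2n−1` passes.  By format monotonicity and the conductor law the run at
`m₀` gives every level `≥ n` at every cell `m ≥ m₀`, in particular at every cell of the tower (`m ≥ n^τ`). [this node] -/
theorem invariantSaturation_of_firstCellRuns
    (h : ∀ τ : ℝ, 2 < τ → τ < 4 → ∃ n₁ : ℕ, ∀ n : ℕ, n₁ ≤ n → 0 < n ∧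
      (∀ m : ℕ, n * n ≤ m → ∀ k : ℕ, 0 < k → k < n → k ∈ emptyLevels m (n * n)) ∧
      ∃ m₀ : ℕ, n * n ≤ m₀ ∧ (m₀ : ℝ) ≤ (n : ℝ) ^ τ ∧ ∀ j : ℕ, j < n → n + j ∈ passLevels m₀ (n * n)) :
    InvariantSaturation := by
  refine invariantSaturation_iff_levels.2 fun τ hτ hτ4 => ?_
  obtain ⟨n₁, hn₁⟩ := h τ hτ hτ4
  refine ⟨n₁, fun n m hn hnm hτm k hk => ?_⟩
  obtain ⟨hn0, hK0, m₀, hm₀, hm₀τ, hrun⟩ := hn₁ n hn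
  rw [Set.mem_union, or_iff_not_imp_right]
  intro hne
  have hk0 : 0 < k := by
    rcases Nat.eq_zero_or_pos k with h0 | h0
    · subst h0; simp at hk
    · exact h0
  have hkn : n ≤ k := by
    by_contra hlt
    exact hne (hK0 m hnm k hk0 (lt_of_not_ge hlt))
  have hm₀m : m₀ ≤ m := by exact_mod_cast hm₀τ.trans hτm
  exact column_of_run hm₀ hn0 hrun m hm₀m k hkn

/-- **H11d at tree level: for `3 < τ < 4` the invariant tower is Kronecker positivity.**  If (K0) and (NE) hold eventually in `n`
at every cell `m ≥ n²`, then the level reading of the tower holds at every scale `3 < τ < 4` — with no hypothesis about `σ_m` and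
none about the unit tensor (compare the landed H6b `invariantSaturation_three_of_unitLevels`, which needs the Latin-cube
hypothesis (U)). PROVED. [this node] -/
theorem invariantSaturation_three_of_nonemptyWindows
    (h : ∃ n₁ : ℕ, ∀ n m : ℕ, n₁ ≤ n → n * n ≤ m →
      (∀ k : ℕ, 0 < k → k < n → k ∈ emptyLevels m (n * n)) ∧
      (∀ k : ℕ, n ≤ k → k < 2 * n → k ∉ emptyLevels m (n * n))) :
    ∀ τ : ℝ, 3 < τ → τ < 4 → ∃ n₀ : ℕ, ∀ n m : ℕ, n₀ ≤ n → n * n ≤ m → (n : ℝ) ^ τ ≤ (m : ℝ) →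
      ∀ k : ℕ, m < k * (n * n) → k ∈ passLevels m (n * n) ∪ emptyLevels m (n * n) := by
  obtain ⟨n₁, h⟩ := h
  intro τ hτ3 _
  obtain ⟨n₂, hn₂⟩ := eventually_primitive_bound_le_rpow hτ3
  refine ⟨max (max n₁ n₂) 1, fun n m hn hnm hτm => ?_⟩
  have hn1 : n₁ ≤ n := le_trans (le_trans (le_max_left _ _) (le_max_left _ _)) hn
  have hn2 : n₂ ≤ n := le_trans (le_trans (le_max_right _ _) (le_max_left _ _)) hn
  have hn0 : 0 < n := lt_of_lt_of_le Nat.one_pos (le_trans (le_max_right _ _) hn)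
  obtain ⟨hK0, hNE⟩ := h n m hn1 hnm
  have hbound : 2 * n * (n * n) ≤ m := by
    have h1 := hn₂ n hn2
    exact_mod_cast h1.trans hτm
  exact tower_of_nonemptyWindow n hn0 hbound hK0 hNE

end Summit.MatrixMultiplication.MatrixMultiplication.Theses.ObstructionDescent

end
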